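import Summits.QuantumFields.BalabanUV.Beta.EriceRemainderEnclosureHistoryAutonomyComparisonMarkovCreditOrbit
import Summits.QuantumFields.BalabanUV.Beta.EriceRemainderEnclosureHistoryAutonomyComparisonDualContractionSharp

/-!
# EriceRemainderEnclosureHistoryAutonomyComparisonMarkovCreditPedestal — (E139g) **THE COMPARISON SIDE OF THE PEDESTAL DICHOTOMY: the pedestal hinge
# `B(w) = 1 + s·max(P − 1∕w_0², 0) + M̃·max(c − 1∕w_L², 0)` of (E139e) with `M̃·(1 − (1+s)^{−L}) ≤ s` compares with its translate `B + ε` (`ε ≥ 0`) — `h′ ≤ h` at every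
# scale — along every perturbed orbit whose hinge reach lies inside the pedestal's active range (`1∕h′_m² + L + 1 < c ⟹ 1∕h′_{m+L+1}² ≤ P`)
# (`le_of_pedestal_hinge`).**  With (E139e) `exists_violation_markov_credit` (`M̃(1 − (1+s)^{−L}) > s ⟹` violation, for an orbit of this kind): the Markov credit law
# `M̃·Σ_{j=1}^{L}(1+s)^{−j} ≤ 1` is the EXACT comparison threshold of the family — an instance of (E139f) `le_of_isotone_excess_markov_credit_orbit` with the graded profile
# `Λ_L(A) = M̃·[A + L + 1 < c]`, `Λ_0 = s`, the Markov slope `μ(A) = s·[A ≤ P]`, and the geometric credit `s·Σ_{j<L}(1+s)^{−(j+1)} = 1 − (1+s)^{−L}` (`geom_credit`).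

Cell `pub-balaban`, β-function sub-cell, BINDER row D4 «RemainderConst leaves for Bałaban's split» (`HOME/BINDER-OWNERS.md`; owner lineage `b2b-balaban-beta-an4`;
this file by co-owner #2 lineage `b2b-balaban-beta-d4-p2`, generation 107), β-FLOW TEAM duty (1), FREEZE (0) honoured (def-free: the functional is a displayed lambda
term; (E139f) `le_of_isotone_excess_markov_credit_orbit`, (E138f) `lhinge_mono` ∕ `lhinge_nonneg` ∕ `lhinge_le` ∕ `abs_lhinge_sub_le` ∕ `lhinge_sub_le_posPart` BY NAME;
nothing restated).  NOT CLAIMED: that (E139e)'s particular orbit satisfies the reach condition beyond the row `0` (its window is certified to the row `L+1` only) — the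
two files give the two sides of the law on the same family, the violation for one compatible orbit and the comparison for every compatible orbit.

HONEST FRAMING (page 1, verbatim and binding).  *"Discharging BetaPertH makes Bałaban's UV stability UNCONDITIONAL — a real constructive-QFT result; it is
NOT the continuum limit and NOT the Clay problem."*  THIS FILE DISCHARGES NOTHING OF THE KIND.  Elementary real analysis about a DISPLAYED abstract functional on a box
]0,γ]^ℕ — a census example, not a fact; nothing about Bałaban's (1.22) limit functional is PRINTED in this form ([I] p. 298; GAPS G-t4-U2-1∕-2) or asserted.  Row D4
class UNCHANGED (critical-path width 0; instance 0∕1; D4 DISCHARGE NO DATE).  NOT B12 Thm 2, NOT BetaPertH, NOT continuum YM, NOT Clay.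

WHAT IS PROVED ([folklore]; 0 `def`, 0 sorry).  §1 `ph_mono`, `ph_zm`, `ph_profile`, `ph_markov`.  §2 `geom_credit`.  §3 **`le_of_pedestal_hinge`**.
-/

noncomputable section
open Finset Set

namespace Summit.QuantumFields.BalabanUV.Beta.EriceRemainderEnclosureHistoryAutonomyComparisonMarkovCreditPedestal

open Literature.MathematicalPhysics.QuantumFieldTheory.Balaban1983to89
open Literature.MathematicalPhysics.QuantumFieldTheory.Balaban1983to89.T4BetaStationary
open Literature.MathematicalPhysics.QuantumFieldTheory.Balaban1983to89.T4BetaFlowWellPosed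
open Summit.QuantumFields.BalabanUV.Beta.EriceRemainderEnclosureHistoryAutonomyComparisonDualContractionSharp
  (lhinge_mono lhinge_nonneg lhinge_le abs_lhinge_sub_le lhinge_sub_le_posPart)
open Summit.QuantumFields.BalabanUV.Beta.EriceRemainderEnclosureHistoryAutonomyComparisonMarkovCreditOrbit (le_of_isotone_excess_markov_credit_orbit)

variable {γ s P c Mt : ℝ} {L : ℕ}

/-! ## §1 The pedestal hinge on a box -/

/-- The pedestal hinge is ISOTONE on the box. [folklore] -/
theorem ph_mono (hs : 0 ≤ s) (hMt : 0 ≤ Mt) : ∀ u v : ℕ → ℝ, SeqBox γ u → SeqBox γ v → (∀ i, u i ≤ v i) →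
    (fun w : ℕ → ℝ => 1 + s * max (P - 1 / w 0 ^ 2) 0 + Mt * max (c - 1 / w L ^ 2) 0) u
      ≤ (fun w : ℕ → ℝ => 1 + s * max (P - 1 / w 0 ^ 2) 0 + Mt * max (c - 1 / w L ^ 2) 0) v := by
  intro u v hu _ huv
  have h0 := lhinge_mono (c := P) (hu 0).1 (huv 0)
  have hLm := lhinge_mono (c := c) (hu L).1 (huv L)
  simp only
  nlinarith [mul_le_mul_of_nonneg_left h0 hs, mul_le_mul_of_nonneg_left hLm hMt]

/-- … has the ZEROTH MOMENT `s·2P√P + M̃·2c√c` on the box (`P, c > 0`). [folklore] -/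
theorem ph_zm (hs : 0 ≤ s) (hMt : 0 ≤ Mt) (hP : 0 < P) (hc : 0 < c) : ∀ u u' : ℕ → ℝ, SeqBox γ u → SeqBox γ u' → ∀ D : ℝ, (∀ j, |u j - u' j| ≤ D) →
    |(fun w : ℕ → ℝ => 1 + s * max (P - 1 / w 0 ^ 2) 0 + Mt * max (c - 1 / w L ^ 2) 0) u
      - (fun w : ℕ → ℝ => 1 + s * max (P - 1 / w 0 ^ 2) 0 + Mt * max (c - 1 / w L ^ 2) 0) u'|
      ≤ (s * (2 * P * Real.sqrt P) + Mt * (2 * c * Real.sqrt c)) * D := by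
  intro u u' hu hu' D hD
  simp only
  rw [show 1 + s * max (P - 1 / u 0 ^ 2) 0 + Mt * max (c - 1 / u L ^ 2) 0 - (1 + s * max (P - 1 / u' 0 ^ 2) 0 + Mt * max (c - 1 / u' L ^ 2) 0)
      = s * (max (P - 1 / u 0 ^ 2) 0 - max (P - 1 / u' 0 ^ 2) 0) + Mt * (max (c - 1 / u L ^ 2) 0 - max (c - 1 / u' L ^ 2) 0) by ring]
  refine (abs_add_le _ _).trans ?_
  rw [abs_mul, abs_mul, abs_of_nonneg hs, abs_of_nonneg hMt]
  have hA' := (abs_lhinge_sub_le (c := P) hP (hu 0).1 (hu' 0).1).trans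
    (mul_le_mul_of_nonneg_left (hD 0) (by positivity : (0 : ℝ) ≤ 2 * P * Real.sqrt P))
  have hB' := (abs_lhinge_sub_le (c := c) hc (hu L).1 (hu' L).1).trans
    (mul_le_mul_of_nonneg_left (hD L) (by positivity : (0 : ℝ) ≤ 2 * c * Real.sqrt c))
  nlinarith [mul_le_mul_of_nonneg_left hA' hs, mul_le_mul_of_nonneg_left hB' hMt]

/-- … carries the LEVEL-GRADED PROFILE `Λ_0(A) = s`, `Λ_L(A) = M̃·[A + L + 1 < c]`, `Λ_k = 0` otherwise (`L ≥ 1`): on the graded box above `A` (age-`k` levels `≥ A + (k+1)`)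
the hinge of age `L` is OFF once `A + L + 1 ≥ c`. [folklore] -/
theorem ph_profile (hs : 0 ≤ s) (hMt : 0 ≤ Mt) (hL : 1 ≤ L) (A : ℝ) : ∀ u v : ℕ → ℝ, SeqBox γ u → SeqBox γ v →
    (∀ k : ℕ, A + ((k : ℝ) + 1) * 1 ≤ 1 / u k ^ 2) → (∀ k : ℕ, A + ((k : ℝ) + 1) * 1 ≤ 1 / v k ^ 2) →
    (fun w : ℕ → ℝ => 1 + s * max (P - 1 / w 0 ^ 2) 0 + Mt * max (c - 1 / w L ^ 2) 0) u
      - (fun w : ℕ → ℝ => 1 + s * max (P - 1 / w 0 ^ 2) 0 + Mt * max (c - 1 / w L ^ 2) 0) v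
      ≤ ∑ k ∈ range (L + 1), (fun (k : ℕ) (A : ℝ) => if k = 0 then s else if k = L then (if A + ((L : ℝ) + 1) < c then Mt else 0) else 0) k A
          * max (1 / v k ^ 2 - 1 / u k ^ 2) 0 := by
  intro u v _ _ hgu hgv
  have hL0 : L ≠ 0 := by omega
  -- the two non-zero terms of the sum
  rw [sum_range_succ]
  have hrest : s * max (1 / v 0 ^ 2 - 1 / u 0 ^ 2) 0 ≤ ∑ k ∈ range L,
      (fun (k : ℕ) (A : ℝ) => if k = 0 then s else if k = L then (if A + ((L : ℝ) + 1) < c then Mt else 0) else 0) k A * max (1 / v k ^ 2 - 1 / u k ^ 2) 0 := by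
    have h0mem : 0 ∈ range L := mem_range.mpr (by omega)
    refine le_trans (le_of_eq ?_) (single_le_sum (f := fun k => (fun (k : ℕ) (A : ℝ) => if k = 0 then s else if k = L then
      (if A + ((L : ℝ) + 1) < c then Mt else 0) else 0) k A * max (1 / v k ^ 2 - 1 / u k ^ 2) 0) (fun k _ => ?_) h0mem)
    · simp
    · simp only
      refine mul_nonneg ?_ (le_max_right _ _)
      split_ifs <;> first | exact hs | exact hMt | exact le_rfl
  have h0 : s * (max (P - 1 / u 0 ^ 2) 0 - max (P - 1 / v 0 ^ 2) 0) ≤ s * max (1 / v 0 ^ 2 - 1 / u 0 ^ 2) 0 :=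
    mul_le_mul_of_nonneg_left (lhinge_sub_le_posPart _ _ _) hs
  have hLterm : Mt * (max (c - 1 / u L ^ 2) 0 - max (c - 1 / v L ^ 2) 0)
      ≤ (if A + ((L : ℝ) + 1) < c then Mt else 0) * max (1 / v L ^ 2 - 1 / u L ^ 2) 0 := by
    split_ifs with hlt
    · exact mul_le_mul_of_nonneg_left (lhinge_sub_le_posPart _ _ _) hMt
    · -- both readings are off: levels ≥ A + L + 1 ≥ c
      have hu' := hgu L
      have hv' := hgv L
      have hge : c ≤ A + ((L : ℝ) + 1) := le_of_not_gt hlt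
      rw [max_eq_right (by linarith), max_eq_right (by linarith)]
      simp
  simp only [hL0, if_true, if_false]
  simp only at hrest
  linarith

/-- … and has the MARKOV LOWER SLOPE `μ(A) = s·[A ≤ P]` (antitone): for configurations agreeing at the ages `≥ 1` with `v_0 ≤ u_0`,
`B v + μ(1∕v_0²)·(1∕v_0² − 1∕u_0²) ≤ B u` (`L ≥ 1`). [folklore] -/
theorem ph_markov (hs : 0 ≤ s) (hL : 1 ≤ L) : ∀ u v : ℕ → ℝ, SeqBox γ u → SeqBox γ v → (∀ i, u (i + 1) = v (i + 1)) → v 0 ≤ u 0 →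
    (fun w : ℕ → ℝ => 1 + s * max (P - 1 / w 0 ^ 2) 0 + Mt * max (c - 1 / w L ^ 2) 0) v
      + (fun A : ℝ => if A ≤ P then s else 0) (1 / v 0 ^ 2) * (1 / v 0 ^ 2 - 1 / u 0 ^ 2)
      ≤ (fun w : ℕ → ℝ => 1 + s * max (P - 1 / w 0 ^ 2) 0 + Mt * max (c - 1 / w L ^ 2) 0) u := by
  intro u v _ hv hagree hle
  have hLu : u L = v L := by obtain ⟨L', rfl⟩ := Nat.exists_eq_add_of_le' hL; exact hagree L'
  simp only
  rw [hLu]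
  split_ifs with hvP
  · rw [max_eq_left (sub_nonneg.mpr hvP)]
    nlinarith [mul_le_mul_of_nonneg_left (le_max_left (P - 1 / u 0 ^ 2) 0) hs]
  · have h1 := lhinge_mono (c := P) (hv 0).1 hle
    nlinarith [mul_le_mul_of_nonneg_left h1 hs]

/-! ## §2 The geometric credit -/

/-- THE GEOMETRIC CREDIT: `s·Σ_{j<L} (1+s)^{−(j+1)} = 1 − (1+s)^{−L}` — so `M̃·Σ_{j<L}(1+s)^{−(j+1)} ≤ 1 ⟺ M̃(1 − (1+s)^{−L}) ≤ s` for `s > 0`. [folklore] -/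
theorem geom_credit (hs : 0 < s) : ∀ L : ℕ, s * ∑ j ∈ range L, ((1 + s)⁻¹) ^ (j + 1) = 1 - ((1 + s)⁻¹) ^ L
  | 0 => by simp
  | L + 1 => by
    have hrs : (1 + s)⁻¹ * (1 + s) = 1 := inv_mul_cancel₀ (by linarith)
    rw [sum_range_succ, mul_add, geom_credit hs L, pow_succ]
    linear_combination ((1 + s)⁻¹) ^ L * hrs

/-! ## §3 The comparison side of the pedestal dichotomy -/

/-- **THE PEDESTAL HINGE COMPARES WHEN `M̃(1 − (1+s)^{−L}) ≤ s`.**  Box `]0,γ]`; `s > 0`, `M̃ ≥ 0`, `L ≥ 1`, cap `P > 0`, activation level `c > 0`, excess `ε ≥ 0`;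
`B(w) = 1 + s·max(P − 1∕w_0², 0) + M̃·max(c − 1∕w_L², 0)`, `B′ = B + ε`; `h, h′` box solutions of `B, B′` from one pin; REACH CONDITION along `h′`: whenever the hinge
can still be active on the graded box above the current level (`1∕h′_m² + L + 1 < c`), the pedestal is active `L+1` rows below (`1∕h′_{m+L+1}² ≤ P`).  If
**`M̃·(1 − (1+s)^{−L}) ≤ s`** then **`h′ ≤ h` at every scale** — (E139f) with `Λ_L(A) = M̃·[A + L + 1 < c]`, `μ(A) = s·[A ≤ P]` and `geom_credit`.  Converse: (E139e)
`exists_violation_markov_credit`. [folklore] -/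
theorem le_of_pedestal_hinge {ε p : ℝ} {h h' : ℕ → ℝ} (hs : 0 < s) (hMt : 0 ≤ Mt) (hL : 1 ≤ L) (hP : 0 < P) (hc : 0 < c) (hε : 0 ≤ ε)
    (hlaw : Mt * (1 - ((1 + s)⁻¹) ^ L) ≤ s) (hp : 0 < p) (hpγ : p ≤ γ)
    (hh : SeqBox γ h) (hf : MemFlow (fun w : ℕ → ℝ => 1 + s * max (P - 1 / w 0 ^ 2) 0 + Mt * max (c - 1 / w L ^ 2) 0) p h)
    (hh' : SeqBox γ h') (hf' : MemFlow (fun w : ℕ → ℝ => (1 + s * max (P - 1 / w 0 ^ 2) 0 + Mt * max (c - 1 / w L ^ 2) 0) + ε) p h')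
    (hreach : ∀ m : ℕ, 1 / h' m ^ 2 + ((L : ℝ) + 1) < c → 1 / h' (m + (L + 1)) ^ 2 ≤ P) (j : ℕ) :
    h' j ≤ h j := by
  have hrs : (1 + s)⁻¹ * (1 + s) = 1 := inv_mul_cancel₀ (by linarith)
  have hr0 : 0 < (1 + s)⁻¹ := inv_pos.mpr (by linarith)
  -- the hypotheses of (E139f)
  have hΛ : ∀ (k : ℕ) (A : ℝ), 0 ≤ (fun (k : ℕ) (A : ℝ) => if k = 0 then s else if k = L then (if A + ((L : ℝ) + 1) < c then Mt else 0) else 0) k A := by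
    intro k A; simp only; split_ifs <;> first | exact hs.le | exact hMt | exact le_rfl
  have hμ0 : ∀ A, 0 ≤ (fun A : ℝ => if A ≤ P then s else 0) A := fun A => by simp only; split_ifs <;> [exact hs.le; exact le_rfl]
  have hμanti : Antitone (fun A : ℝ => if A ≤ P then s else 0) := by
    intro a a' haa'
    simp only
    split_ifs with h1 h2 h2 <;> first | exact le_rfl | exact hs.le | exact absurd (haa'.trans h1) h2
  have hlo : ∀ u, SeqBox γ u → (1 : ℝ) ≤ (fun w : ℕ → ℝ => 1 + s * max (P - 1 / w 0 ^ 2) 0 + Mt * max (c - 1 / w L ^ 2) 0) u := fun u _ => by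
    simp only; nlinarith [mul_nonneg hs.le (lhinge_nonneg P (u 0)), mul_nonneg hMt (lhinge_nonneg c (u L))]
  have hbdd : ∀ u, SeqBox γ u → (fun w : ℕ → ℝ => (1 + s * max (P - 1 / w 0 ^ 2) 0 + Mt * max (c - 1 / w L ^ 2) 0) + ε) u ≤ 1 + s * P + Mt * c + ε :=
    fun u _ => by
      simp only; nlinarith [mul_le_mul_of_nonneg_left (lhinge_le hP.le (u 0)) hs.le, mul_le_mul_of_nonneg_left (lhinge_le hc.le (u L)) hMt]
  have hdeep : ∃ A₀ : ℝ, ∀ A, A₀ ≤ A → ∑ k ∈ range (L + 1), (k : ℝ) *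
      (fun (k : ℕ) (A : ℝ) => if k = 0 then s else if k = L then (if A + ((L : ℝ) + 1) < c then Mt else 0) else 0) k A < 1 := by
    refine ⟨c, fun A hA => ?_⟩
    rw [sum_eq_zero]
    · exact zero_lt_one
    · intro k _
      simp only
      split_ifs with h0 hkL hlt
      · rw [h0]; simp
      · have : (0 : ℝ) ≤ L := Nat.cast_nonneg L
        linarith
      · simp
      · simp
  have hrow : ∀ m : ℕ, ∑ k ∈ range (L + 1),
      (fun (k : ℕ) (A : ℝ) => if k = 0 then s else if k = L then (if A + ((L : ℝ) + 1) < c then Mt else 0) else 0) k (1 / h' m ^ 2)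
        * ∑ j ∈ range k, ((1 + (fun A : ℝ => if A ≤ P then s else 0) (1 / h' (m + (L + 1)) ^ 2))⁻¹) ^ (j + 1) ≤ 1 := by
    intro m
    have hL0 : L ≠ 0 := by omega
    beta_reduce
    have hzero : ∑ k ∈ range L, (if k = 0 then s else if k = L then (if 1 / h' m ^ 2 + ((L : ℝ) + 1) < c then Mt else 0) else 0)
        * ∑ j ∈ range k, ((1 + (if 1 / h' (m + (L + 1)) ^ 2 ≤ P then s else 0))⁻¹) ^ (j + 1) = 0 := by
      refine sum_eq_zero fun k hk => ?_
      have hkL : k < L := mem_range.mp hk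
      rcases Nat.eq_zero_or_pos k with h0 | hpos
      · subst h0; rw [sum_range_zero, mul_zero]
      · rw [if_neg (by omega), if_neg (by omega), zero_mul]
    rw [sum_range_succ, hzero, zero_add, if_neg hL0, if_pos rfl]
    by_cases hlt : 1 / h' m ^ 2 + ((L : ℝ) + 1) < c
    · rw [if_pos hlt, if_pos (hreach m hlt)]
      have hg := geom_credit hs L
      have hS0 : 0 ≤ ∑ j ∈ range L, ((1 + s)⁻¹) ^ (j + 1) := sum_nonneg fun j _ => pow_nonneg hr0.le _
      nlinarith
    · rw [if_neg hlt, zero_mul]; exact zero_le_one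
  have hexc : ∀ u : ℕ → ℝ, SeqBox γ u → 1 + s * max (P - 1 / u 0 ^ 2) 0 + Mt * max (c - 1 / u L ^ 2) 0
      ≤ (1 + s * max (P - 1 / u 0 ^ 2) 0 + Mt * max (c - 1 / u L ^ 2) 0) + ε := fun u _ => by linarith
  have hDmono : ∀ u v : ℕ → ℝ, SeqBox γ u → SeqBox γ v → (∀ i, u i ≤ v i) →
      (1 + s * max (P - 1 / u 0 ^ 2) 0 + Mt * max (c - 1 / u L ^ 2) 0) + ε - (1 + s * max (P - 1 / u 0 ^ 2) 0 + Mt * max (c - 1 / u L ^ 2) 0)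
        ≤ (1 + s * max (P - 1 / v 0 ^ 2) 0 + Mt * max (c - 1 / v L ^ 2) 0) + ε - (1 + s * max (P - 1 / v 0 ^ 2) 0 + Mt * max (c - 1 / v L ^ 2) 0) :=
    fun u v _ _ _ => by linarith
  exact le_of_isotone_excess_markov_credit_orbit (B := fun w : ℕ → ℝ => 1 + s * max (P - 1 / w 0 ^ 2) 0 + Mt * max (c - 1 / w L ^ 2) 0)
    (B' := fun w : ℕ → ℝ => (1 + s * max (P - 1 / w 0 ^ 2) 0 + Mt * max (c - 1 / w L ^ 2) 0) + ε)
    (Λ := fun (k : ℕ) (A : ℝ) => if k = 0 then s else if k = L then (if A + ((L : ℝ) + 1) < c then Mt else 0) else 0)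
    (μ := fun A : ℝ => if A ≤ P then s else 0) (K := L + 1)
    (ph_mono hs.le hMt) (ph_zm hs.le hMt hP hc) (by positivity) one_pos hlo hΛ (fun A => ph_profile hs.le hMt hL A) hdeep hμ0 hμanti
    (ph_markov hs.le hL) hexc hbdd hDmono hp hpγ hh hf hh' hf' hrow j

end Summit.QuantumFields.BalabanUV.Beta.EriceRemainderEnclosureHistoryAutonomyComparisonMarkovCreditPedestal

end
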